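import Mathlib.Analysis.SpecialFunctions.NonIntegrable
import Summits.KontsevichZagierPeriods.KontsevichZagierPeriods.Theorems.HurwitzMicroSectorsNormalFormPrincipleRatVanishing

/-!
# `NormalFormPrinciple` (stmt-KontsevichZagierPeriods-3869), line `SketchIdeator1` —
# the leaf `stub_boxRigidity` in dimensions `m, m' ≤ 1`, literally

Pure proof file (lead seat c3; `--supports` the crux). The registered stub `stub_boxRigidity` quantifies
over representations on OPEN unit boxes with integrands of KZ's rational shape (`IsRational`:
`p/q`, `p, q ∈ ℚ[x₀,…]`, `q ≠ 0` on the open box). Here its instance `m, m' ≤ 1` is proved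
(`boxRigidity_of_le_one`): a one-variable rational integrand is brought to reduced form, a zero of the
reduced denominator at an end point is excluded by absolute integrability (`|P/Q| ≥ C/|t−ρ|` near a
pole, and `(t−ρ)⁻¹` is not integrable there), so `box_rat`-rigidity (`nfD_of_dvd`,
`nfD_eq_zero_of_eval_eq_zero`) applies; dimension `0` gives rational points; mixed dimensions go through
the mixed normal form of the difference (`nfD_neg`).

Sources: M. Kontsevich, D. Zagier, *Periods* (2001), §1.2 Conjecture 1; A. Baker, *Transcendental Number Theory* (1975), Thm. 2.1. No definitions are introduced.
-/

noncomputable section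

open MeasureTheory Set Finset
open scoped Polynomial
open Literature.NumberTheory.Transcendental Literature.NumberTheory.Transcendental.KZ
open Literature.ModelTheory.ExponentialFields (IsSemialgebraic isSemialgebraic_univ)

namespace Summit.KontsevichZagierPeriods.HurwitzMicroSectors.NormalFormPrinciple.PiBox

namespace Dlog

open Summit.KontsevichZagierPeriods.HurwitzMicroSectors.NormalFormPrinciple.Negative
  (setIntegral_fin_one integrableOn_fin_one)

/-! ## From `MvPolynomial (Fin 1) ℚ` and `MvPolynomial (Fin 0) ℚ` to one variable and constants -/

/-- A polynomial in the single variable `x₀` is a one-variable polynomial evaluated at `x 0`.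
[folklore] -/
theorem aeval_fin_one_eq (p : MvPolynomial (Fin 1) ℚ) (x : Fin 1 → ℝ) :
    (Polynomial.aeval (x 0) (MvPolynomial.aeval (fun _ : Fin 1 => (Polynomial.X : ℚ[X])) p) : ℝ) =
      MvPolynomial.aeval x p := by
  have h := congrArg (fun φ : MvPolynomial (Fin 1) ℚ →ₐ[ℚ] ℝ => φ p)
    (MvPolynomial.comp_aeval (R := ℚ) (fun _ : Fin 1 => (Polynomial.X : ℚ[X])) (Polynomial.aeval (x 0)))
  simp only [AlgHom.comp_apply, Polynomial.aeval_X] at h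
  have hx : (fun _ : Fin 1 => x 0) = x := funext fun i => by rw [Fin.fin_one_eq_zero i]
  rw [h, hx]

/-- A polynomial in no variables evaluates to (the cast of) its constant coefficient. [folklore] -/
theorem aeval_fin_zero_eq (p : MvPolynomial (Fin 0) ℚ) (x : Fin 0 → ℝ) :
    MvPolynomial.aeval x p = ((p.coeff 0 : ℚ) : ℝ) := by
  conv_lhs => rw [MvPolynomial.eq_C_of_isEmpty p]
  rw [MvPolynomial.aeval_C, eq_ratCast]

/-- Evaluation of a rational polynomial at a rational point, inside `ℝ`. [folklore] -/
theorem aeval_ratCast_eq (P : ℚ[X]) (ρ : ℚ) : (Polynomial.aeval (ρ : ℝ) P : ℝ) = ((P.eval ρ : ℚ) : ℝ) := by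
  have e : (ρ : ℝ) = algebraMap ℚ ℝ ρ := (eq_ratCast _ _).symm
  rw [e, Polynomial.aeval_algebraMap_apply_eq_algebraMap_eval, eq_ratCast]

/-! ## A pole of the reduced integrand at an end point is not integrable -/

/-- **Lower bound near a pole.** If `Q(ρ) = 0 ≠ P(ρ)` (`P, Q ∈ ℚ[X]`, `Q ≠ 0`, `ρ ∈ ℚ`) then
`|P(t)/Q(t)| ≥ C/|t − ρ|` for `0 < |t − ρ| < δ` wherever `Q(t) ≠ 0`, for some `C, δ > 0`. [folklore] -/
theorem exists_lower_bound_near_root (P Q : ℚ[X]) (hQ : Q ≠ 0) {ρ : ℚ} (hQρ : Q.IsRoot ρ)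
    (hPρ : ¬ P.IsRoot ρ) :
    ∃ δ > 0, ∃ C > 0, ∀ t : ℝ, 0 < |t - ρ| → |t - ρ| < δ → (Polynomial.aeval t Q : ℝ) ≠ 0 →
      C / |t - ρ| ≤ |(Polynomial.aeval t P : ℝ) / Polynomial.aeval t Q| := by
  obtain ⟨R, hQR, hndvd⟩ := Q.exists_eq_pow_rootMultiplicity_mul_and_not_dvd hQ ρ
  have hk : 0 < Q.rootMultiplicity ρ := (Polynomial.rootMultiplicity_pos hQ).mpr hQρ
  set k := Q.rootMultiplicity ρ with hk_def
  have hRρ : R.eval ρ ≠ 0 := fun h => hndvd (Polynomial.dvd_iff_isRoot.mpr h)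
  -- the real values at `ρ`
  set Pρ : ℝ := ((P.eval ρ : ℚ) : ℝ) with hPρ_def
  set Rρ : ℝ := ((R.eval ρ : ℚ) : ℝ) with hRρ_def
  have hPρ0 : Pρ ≠ 0 := by rw [hPρ_def]; exact_mod_cast hPρ
  have hRρ0 : Rρ ≠ 0 := by rw [hRρ_def]; exact_mod_cast hRρ
  have hPa : 0 < |Pρ| := abs_pos.mpr hPρ0
  have hRa : 0 < |Rρ| := abs_pos.mpr hRρ0
  -- continuity of `P` and `R` at `ρ`
  have hcP := Metric.continuous_iff.mp (Polynomial.continuous_aeval (R := ℚ) (A := ℝ) P) (ρ : ℝ)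
    (|Pρ| / 2) (by positivity)
  have hcR := Metric.continuous_iff.mp (Polynomial.continuous_aeval (R := ℚ) (A := ℝ) R) (ρ : ℝ)
    |Rρ| hRa
  obtain ⟨δ₁, hδ₁, hP⟩ := hcP
  obtain ⟨δ₂, hδ₂, hR⟩ := hcR
  refine ⟨min (min δ₁ δ₂) 1, by positivity, |Pρ| / 2 / (2 * |Rρ|), by positivity, ?_⟩
  intro t ht0 htδ hQt
  have ht1 : |t - ρ| < δ₁ := lt_of_lt_of_le htδ ((min_le_left _ _).trans (min_le_left _ _))
  have ht2 : |t - ρ| < δ₂ := lt_of_lt_of_le htδ ((min_le_left _ _).trans (min_le_right _ _))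
  have ht3 : |t - ρ| < 1 := lt_of_lt_of_le htδ (min_le_right _ _)
  have hPt : |Pρ| / 2 ≤ |(Polynomial.aeval t P : ℝ)| := by
    have h := hP t (by rwa [Real.dist_eq])
    rw [Real.dist_eq, aeval_ratCast_eq] at h
    have := abs_sub_abs_le_abs_sub Pρ (Polynomial.aeval t P : ℝ)
    rw [abs_sub_comm] at this
    linarith
  have hRt : |(Polynomial.aeval t R : ℝ)| ≤ 2 * |Rρ| := by
    have h := hR t (by rwa [Real.dist_eq])
    rw [Real.dist_eq, aeval_ratCast_eq] at h
    have := abs_sub_abs_le_abs_sub (Polynomial.aeval t R : ℝ) Rρ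
    linarith
  -- the factorisation over `ℝ`
  have hQt' : (Polynomial.aeval t Q : ℝ) = (t - ρ) ^ k * Polynomial.aeval t R := by
    conv_lhs => rw [hQR]
    rw [map_mul, map_pow, map_sub, Polynomial.aeval_X, Polynomial.aeval_C, eq_ratCast]
  have hRt0 : (Polynomial.aeval t R : ℝ) ≠ 0 := by
    intro h; apply hQt; rw [hQt', h, mul_zero]
  have hRta : 0 < |(Polynomial.aeval t R : ℝ)| := abs_pos.mpr hRt0
  have hpow : |t - ρ| ^ k ≤ |t - ρ| := pow_le_of_le_one (abs_nonneg _) ht3.le hk.ne'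
  have hpow0 : 0 < |t - ρ| ^ k := pow_pos ht0 _
  rw [hQt', abs_div, abs_mul, abs_pow, div_le_div_iff₀ ht0 (mul_pos hpow0 hRta)]
  calc |Pρ| / 2 / (2 * |Rρ|) * (|t - ρ| ^ k * |(Polynomial.aeval t R : ℝ)|)
      ≤ |Pρ| / 2 / (2 * |Rρ|) * (|t - ρ| * (2 * |Rρ|)) := by
        refine mul_le_mul_of_nonneg_left ?_ (by positivity)
        exact mul_le_mul hpow hRt hRta.le (abs_nonneg _)
    _ = |Pρ| / 2 * |t - ρ| := by field_simp
    _ ≤ |(Polynomial.aeval t P : ℝ)| * |t - ρ| := mul_le_mul_of_nonneg_right hPt (abs_nonneg _)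

/-- **A `C/|t − ρ|` lower bound at an end point of an interval contradicts integrability** (the
function `(t − ρ)⁻¹` is not integrable near `ρ`, `intervalIntegrable_sub_inv_iff`). [folklore] -/
theorem false_of_integrableOn_of_lower_bound {f : ℝ → ℝ} {a b ρ C : ℝ} (hab : a < b) (hρ : ρ ∈ Set.Icc a b)
    (hC : 0 < C) (hf : IntegrableOn f (Set.Ioo a b)) (hbound : ∀ t ∈ Set.Ioo a b, C / |t - ρ| ≤ |f t|) :
    False := by
  have hint : IntegrableOn (fun t => (t - ρ)⁻¹) (Set.Ioo a b) := by
    refine Integrable.mono' (hf.norm.const_mul C⁻¹)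
      ((measurable_id.sub_const ρ).inv.aestronglyMeasurable) ?_
    refine (ae_restrict_iff' measurableSet_Ioo).mpr (ae_of_all _ fun t ht => ?_)
    rw [Real.norm_eq_abs, Real.norm_eq_abs, abs_inv]
    by_cases htρ : t - ρ = 0
    · rw [htρ, abs_zero, inv_zero]; positivity
    · have h := hbound t ht
      have hpos : 0 < |t - ρ| := abs_pos.mpr htρ
      calc |t - ρ|⁻¹ = C⁻¹ * (C / |t - ρ|) := by field_simp
        _ ≤ C⁻¹ * |f t| := mul_le_mul_of_nonneg_left h (by positivity)
  have hii : IntervalIntegrable (fun t => (t - ρ)⁻¹) volume a b :=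
    (intervalIntegrable_iff_integrableOn_Ioo_of_le hab.le).mpr hint
  rcases intervalIntegrable_sub_inv_iff.mp hii with h | h
  · exact hab.ne h
  · exact h (by rw [Set.uIcc_of_le hab.le]; exact hρ)

/-! ## The reduced form of a rational integrand on the open unit slab -/

/-- **Reduced form.** A representation on the open unit slab of KZ's rational shape (`IsRational`:
`p/q`, `p, q ∈ ℚ[x₀]`, `q ≠ 0` on the OPEN slab) has integrand `P/Q` with `P, Q ∈ ℚ[X]` coprime and
`Q` without zeros on the CLOSED interval `[0,1]`: a zero of the reduced denominator at an end point
would be a pole of order `≥ 1` of the integrand, contradicting absolute integrability.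
[cite: KontsevichZagier2001, §1.1] -/
theorem exists_reduced_of_isRational (N : IntegralRep 1) (hNd : N.domain = {x | x 0 ∈ Set.Ioo (0:ℝ) 1})
    (hN : N.IsRational) :
    ∃ P Q : ℚ[X], Q ≠ 0 ∧ (∀ t ∈ Set.Icc (0:ℝ) 1, (Polynomial.aeval t Q : ℝ) ≠ 0) ∧
      EqOn N.integrand (fun x => (Polynomial.aeval (x 0) P : ℝ) / Polynomial.aeval (x 0) Q) N.domain := by
  obtain ⟨pm, qm, hq, hEq⟩ := hN
  set P₀ : ℚ[X] := MvPolynomial.aeval (fun _ : Fin 1 => (Polynomial.X : ℚ[X])) pm with hP₀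
  set Q₀ : ℚ[X] := MvPolynomial.aeval (fun _ : Fin 1 => (Polynomial.X : ℚ[X])) qm with hQ₀
  have hQ₀t : ∀ t ∈ Set.Ioo (0:ℝ) 1, (Polynomial.aeval t Q₀ : ℝ) ≠ 0 := by
    intro t ht
    have h := hq (fun _ => t) (by rw [hNd]; exact ht)
    rwa [← aeval_fin_one_eq] at h
  have hQ₀0 : Q₀ ≠ 0 := by
    intro h
    exact hQ₀t (1/2) ⟨by norm_num, by norm_num⟩ (by rw [h, map_zero])
  have hEq₀ : EqOn N.integrand (fun x => (Polynomial.aeval (x 0) P₀ : ℝ) / Polynomial.aeval (x 0) Q₀)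
      N.domain := fun x hx => by
    rw [hEq hx]
    show MvPolynomial.aeval x pm / MvPolynomial.aeval x qm =
      Polynomial.aeval (x 0) P₀ / Polynomial.aeval (x 0) Q₀
    rw [← aeval_fin_one_eq pm x, ← aeval_fin_one_eq qm x]
  -- divide by the gcd
  set G := EuclideanDomain.gcd P₀ Q₀ with hG
  have hG0 : G ≠ 0 := fun h => hQ₀0 (EuclideanDomain.gcd_eq_zero_iff.mp h).2
  set P : ℚ[X] := P₀ / G with hP_def
  set Q : ℚ[X] := Q₀ / G with hQ_def
  have hP : P₀ = G * P := (EuclideanDomain.mul_div_cancel' hG0 (EuclideanDomain.gcd_dvd_left P₀ Q₀)).symm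
  have hQ : Q₀ = G * Q := (EuclideanDomain.mul_div_cancel' hG0 (EuclideanDomain.gcd_dvd_right P₀ Q₀)).symm
  have hQ0 : Q ≠ 0 := by
    intro h; apply hQ₀0; rw [hQ, h, mul_zero]
  have hcop : IsCoprime P Q := by
    have h := EuclideanDomain.gcd_eq_gcd_ab P₀ Q₀
    rw [← hG] at h
    refine ⟨EuclideanDomain.gcdA P₀ Q₀, EuclideanDomain.gcdB P₀ Q₀, mul_left_cancel₀ hG0 ?_⟩
    calc G * (EuclideanDomain.gcdA P₀ Q₀ * P + EuclideanDomain.gcdB P₀ Q₀ * Q)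
        = (G * P) * EuclideanDomain.gcdA P₀ Q₀ + (G * Q) * EuclideanDomain.gcdB P₀ Q₀ := by ring
      _ = G := by rw [← hP, ← hQ, ← h]
      _ = G * 1 := (mul_one G).symm
  have hGt : ∀ t ∈ Set.Ioo (0:ℝ) 1, (Polynomial.aeval t G : ℝ) ≠ 0 := by
    intro t ht h; apply hQ₀t t ht; rw [hQ, map_mul, h, zero_mul]
  have hQt : ∀ t ∈ Set.Ioo (0:ℝ) 1, (Polynomial.aeval t Q : ℝ) ≠ 0 := by
    intro t ht h; apply hQ₀t t ht; rw [hQ, map_mul, h, mul_zero]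
  have hEq' : EqOn N.integrand (fun x => (Polynomial.aeval (x 0) P : ℝ) / Polynomial.aeval (x 0) Q)
      N.domain := by
    intro x hx
    rw [hEq₀ hx]
    have hx' : x 0 ∈ Set.Ioo (0:ℝ) 1 := by rw [hNd] at hx; exact hx
    show (Polynomial.aeval (x 0) P₀ : ℝ) / Polynomial.aeval (x 0) Q₀ = _
    rw [hP, hQ, map_mul, map_mul, mul_div_mul_left _ _ (hGt (x 0) hx')]
  -- integrability of the reduced integrand on the open interval
  have hint : IntegrableOn (fun t : ℝ => (Polynomial.aeval t P : ℝ) / Polynomial.aeval t Q) (Set.Ioo (0:ℝ) 1) := by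
    have h1 : IntegrableOn (fun x : Fin 1 → ℝ => (Polynomial.aeval (x 0) P : ℝ) / Polynomial.aeval (x 0) Q)
        N.domain :=
      N.integrableOn.congr_fun hEq' (IsSemialgebraic.measurableSet_holds N.isSemialgebraic_domain)
    rw [hNd, integrableOn_fin_one] at h1
    exact h1
  -- no zero of `Q` at the end points
  have hnoroot : ∀ ρ : ℚ, (ρ = 0 ∨ ρ = 1) → ¬ Q.IsRoot ρ := by
    intro ρ hρ hQρ
    have hPρ : ¬ P.IsRoot ρ := by
      intro hPρ
      exact Polynomial.not_isUnit_X_sub_C ρ (hcop.isUnit_of_dvd' (Polynomial.dvd_iff_isRoot.mpr hPρ)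
        (Polynomial.dvd_iff_isRoot.mpr hQρ))
    obtain ⟨δ, hδ, C, hC, hb⟩ := exists_lower_bound_near_root P Q hQ0 hQρ hPρ
    rcases hρ with rfl | rfl
    · -- pole at `0`: the interval `(0, b)`
      set b : ℝ := min (δ / 2) (1 / 2) with hb_def
      have hb0 : 0 < b := by positivity
      have hb1 : b < 1 := lt_of_le_of_lt (min_le_right _ _) (by norm_num)
      refine false_of_integrableOn_of_lower_bound (ρ := ((0:ℚ) : ℝ)) hb0
        ⟨by simp, by simp; exact hb0.le⟩ hC (hint.mono_set (Set.Ioo_subset_Ioo_right hb1.le)) ?_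
      intro t ht
      have ht01 : t ∈ Set.Ioo (0:ℝ) 1 := ⟨ht.1, lt_trans ht.2 hb1⟩
      have habs : |t - ((0:ℚ) : ℝ)| = t := by rw [Rat.cast_zero, sub_zero, abs_of_pos ht.1]
      refine hb t (by rw [habs]; exact ht.1) (by rw [habs]; linarith [ht.2, min_le_left (δ / 2) (1 / 2)])
        (hQt t ht01)
    · -- pole at `1`: the interval `(a, 1)`
      set a : ℝ := max (1 - δ / 2) (1 / 2) with ha_def
      have ha1 : a < 1 := max_lt (by linarith) (by norm_num)
      have ha0 : 0 < a := lt_of_lt_of_le (by norm_num) (le_max_right _ _)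
      refine false_of_integrableOn_of_lower_bound (ρ := ((1:ℚ) : ℝ)) ha1
        ⟨by simp; exact ha1.le, by simp⟩ hC (hint.mono_set (Set.Ioo_subset_Ioo_left ha0.le)) ?_
      intro t ht
      have ht01 : t ∈ Set.Ioo (0:ℝ) 1 := ⟨lt_trans ha0 ht.1, ht.2⟩
      have habs : |t - ((1:ℚ) : ℝ)| = 1 - t := by
        rw [Rat.cast_one, abs_sub_comm, abs_of_pos (by linarith [ht.2])]
      refine hb t (by rw [habs]; linarith [ht.2]) (by rw [habs]; linarith [ht.1, le_max_left (1 - δ / 2) (1 / 2)])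
        (hQt t ht01)
  refine ⟨P, Q, hQ0, fun t ht => ?_, hEq'⟩
  rcases ht.1.eq_or_lt with h0 | h0
  · rw [← h0]
    have h := hnoroot 0 (Or.inl rfl)
    rw [Polynomial.IsRoot.def] at h
    have e : (Polynomial.aeval (0:ℝ) Q : ℝ) = ((Q.eval 0 : ℚ) : ℝ) := by
      rw [← aeval_ratCast_eq, Rat.cast_zero]
    rw [e]; exact_mod_cast h
  rcases ht.2.eq_or_lt with h1 | h1
  · rw [h1]
    have h := hnoroot 1 (Or.inr rfl)
    rw [Polynomial.IsRoot.def] at h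
    have e : (Polynomial.aeval (1:ℝ) Q : ℝ) = ((Q.eval 1 : ℚ) : ℝ) := by
      rw [← aeval_ratCast_eq, Rat.cast_one]
    rw [e]; exact_mod_cast h
  exact hQt t ⟨h0, h1⟩

/-! ## Rational representations of dimension `≤ 1` are mixed normal forms -/

variable {RA : ℝ → ℝ → ℝ → IntegralRep 1} {ZA : ℝ → IntegralRep 0} {RG : ℝ → ℝ → IntegralRep 1}

/-- **Negation of a mixed normal form** is a mixed normal form (negate `r`, the `cⱼ` and the `d_l`).
[cite: KontsevichZagier2001, §1.2 rule (1)] -/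
theorem nfD_neg
    (hR : ∀ a b c, IsAlgebraic ℚ a → IsAlgebraic ℚ b → IsAlgebraic ℚ c → 0 < a →
      (RA a b c).domain = {x | x 0 ∈ Set.Ioo a b} ∧ (RA a b c).integrand = fun x => c / x 0)
    (hZ : ∀ r, IsAlgebraic ℚ r → (ZA r).domain = univ ∧ (ZA r).integrand = fun _ => r)
    (hRG : ∀ t d, IsAlgebraic ℚ t → IsAlgebraic ℚ d →
      (RG t d).domain = {x | x 0 ∈ Set.Ioo 0 t} ∧ (RG t d).integrand = fun x => d / (1 + x 0 ^ 2))
    {x : FormalRep ⧸ relations}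
    (hx : ∃ (r : ℝ) (k : ℕ) (u c : Fin k → ℝ) (k' : ℕ) (t d : Fin k' → ℝ), IsAlgebraic ℚ r ∧ (∀ j, 1 < u j) ∧
      (∀ j, IsAlgebraic ℚ (u j)) ∧ (∀ j, IsAlgebraic ℚ (c j)) ∧ (∀ l, 0 ≤ t l) ∧
      (∀ l, IsAlgebraic ℚ (t l)) ∧ (∀ l, IsAlgebraic ℚ (d l)) ∧
      x = QuotientAddGroup.mk' relations (of (ZA r)) +
        ∑ j, QuotientAddGroup.mk' relations (of (RA 1 (u j) (c j))) +
        ∑ l, QuotientAddGroup.mk' relations (of (RG (t l) (d l)))) :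
    ∃ (r : ℝ) (k : ℕ) (u c : Fin k → ℝ) (k' : ℕ) (t d : Fin k' → ℝ), IsAlgebraic ℚ r ∧ (∀ j, 1 < u j) ∧
      (∀ j, IsAlgebraic ℚ (u j)) ∧ (∀ j, IsAlgebraic ℚ (c j)) ∧ (∀ l, 0 ≤ t l) ∧
      (∀ l, IsAlgebraic ℚ (t l)) ∧ (∀ l, IsAlgebraic ℚ (d l)) ∧
      -x = QuotientAddGroup.mk' relations (of (ZA r)) +
        ∑ j, QuotientAddGroup.mk' relations (of (RA 1 (u j) (c j))) +
        ∑ l, QuotientAddGroup.mk' relations (of (RG (t l) (d l))) := by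
  obtain ⟨r, k, u, c, k', t, d, hr, hu1, hu, hc, ht0, ht, hd, rfl⟩ := hx
  refine ⟨-r, k, u, fun j => -c j, k', t, fun l => -d l, hr.neg, hu1, hu, fun j => (hc j).neg, ht0, ht,
    fun l => (hd l).neg, ?_⟩
  have hpt : QuotientAddGroup.mk' relations (of (ZA (-r))) = -QuotientAddGroup.mk' relations (of (ZA r)) := by
    have h := pt_add_mem_relations (r := r) (r' := -r) (ZA 0) (ZA r) (ZA (-r))
      (hZ 0 isAlgebraic_zero).1 (hZ _ hr).1 (hZ _ hr.neg).1 (by rw [(hZ 0 isAlgebraic_zero).2, add_neg_cancel])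
      (hZ _ hr).2 (hZ _ hr.neg).2
    have h0 : QuotientAddGroup.mk' relations (of (ZA 0)) = 0 :=
      (QuotientAddGroup.eq_zero_iff _).mpr (pt_zero_mem_relations (ZA 0) (hZ 0 isAlgebraic_zero).2)
    rw [← QuotientAddGroup.eq_zero_iff] at h
    change QuotientAddGroup.mk' relations _ = 0 at h
    rw [map_sub, map_sub, h0, zero_sub, sub_eq_zero] at h
    exact h.symm
  rw [hpt, neg_add, neg_add, ← Finset.sum_neg_distrib, ← Finset.sum_neg_distrib]
  congr 1
  · congr 1
    exact Finset.sum_congr rfl fun j _ => (carrierA_neg_eq hR (hu j) (hc j)).symm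
  · exact Finset.sum_congr rfl fun l _ => (ang_neg_eq hRG (ht l) (hd l)).symm

/-- **A rational representation on the open unit slab is a mixed normal form.**
[cite: KontsevichZagier2001, §1.2] -/
theorem nfD_of_isRational_one
    (hR : ∀ a b c, IsAlgebraic ℚ a → IsAlgebraic ℚ b → IsAlgebraic ℚ c → 0 < a →
      (RA a b c).domain = {x | x 0 ∈ Set.Ioo a b} ∧ (RA a b c).integrand = fun x => c / x 0)
    (hZ : ∀ r, IsAlgebraic ℚ r → (ZA r).domain = univ ∧ (ZA r).integrand = fun _ => r)
    (hRG : ∀ t d, IsAlgebraic ℚ t → IsAlgebraic ℚ d →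
      (RG t d).domain = {x | x 0 ∈ Set.Ioo 0 t} ∧ (RG t d).integrand = fun x => d / (1 + x 0 ^ 2))
    (N : IntegralRep 1) (hNd : N.domain = {x | x 0 ∈ Set.Ioo (0:ℝ) 1}) (hN : N.IsRational) :
    ∃ (r : ℝ) (k : ℕ) (u c : Fin k → ℝ) (k' : ℕ) (t d : Fin k' → ℝ), IsAlgebraic ℚ r ∧ (∀ j, 1 < u j) ∧
      (∀ j, IsAlgebraic ℚ (u j)) ∧ (∀ j, IsAlgebraic ℚ (c j)) ∧ (∀ l, 0 ≤ t l) ∧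
      (∀ l, IsAlgebraic ℚ (t l)) ∧ (∀ l, IsAlgebraic ℚ (d l)) ∧
      QuotientAddGroup.mk' relations (of N) = QuotientAddGroup.mk' relations (of (ZA r)) +
        ∑ j, QuotientAddGroup.mk' relations (of (RA 1 (u j) (c j))) +
        ∑ l, QuotientAddGroup.mk' relations (of (RG (t l) (d l))) := by
  obtain ⟨p, q, hq, hq01, hNi⟩ := exists_reduced_of_isRational N hNd hN
  set K := algebraicClosure ℚ ℝ
  have hqK0 : q.map (algebraMap ℚ K) ≠ 0 := (Polynomial.map_ne_zero_iff (algebraMap ℚ K).injective).mpr hq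
  have haevq : ∀ t : ℝ, (Polynomial.aeval t (q.map (algebraMap ℚ K)) : ℝ) = Polynomial.aeval t q :=
    fun t => Polynomial.aeval_map_algebraMap K t q
  have haevp : ∀ t : ℝ, (Polynomial.aeval t (p.map (algebraMap ℚ K)) : ℝ) = Polynomial.aeval t p :=
    fun t => Polynomial.aeval_map_algebraMap K t p
  exact nfD_of_dvd hR hZ hRG hq _ (p.map (algebraMap ℚ K)) (q.map (algebraMap ℚ K)) N hqK0 le_rfl dvd_rfl
    (fun t ht => by rw [haevq]; exact hq01 t ht) hNd
    (fun x hx => by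
      rw [hNi hx]
      show (Polynomial.aeval (x 0) p : ℝ) / Polynomial.aeval (x 0) q =
        Polynomial.aeval (x 0) (p.map (algebraMap ℚ K)) / Polynomial.aeval (x 0) (q.map (algebraMap ℚ K))
      rw [haevp, haevq])

/-- **A rational representation of dimension zero is a rational point**, a mixed normal form.
[cite: KontsevichZagier2001, §1.2] -/
theorem nfD_of_isRational_zero
    (hZ : ∀ r, IsAlgebraic ℚ r → (ZA r).domain = univ ∧ (ZA r).integrand = fun _ => r)
    (N : IntegralRep 0) (hNd : N.domain = univ) (hN : N.IsRational) :
    ∃ (r : ℝ) (k : ℕ) (u c : Fin k → ℝ) (k' : ℕ) (t d : Fin k' → ℝ), IsAlgebraic ℚ r ∧ (∀ j, 1 < u j) ∧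
      (∀ j, IsAlgebraic ℚ (u j)) ∧ (∀ j, IsAlgebraic ℚ (c j)) ∧ (∀ l, 0 ≤ t l) ∧
      (∀ l, IsAlgebraic ℚ (t l)) ∧ (∀ l, IsAlgebraic ℚ (d l)) ∧
      QuotientAddGroup.mk' relations (of N) = QuotientAddGroup.mk' relations (of (ZA r)) +
        ∑ j, QuotientAddGroup.mk' relations (of (RA 1 (u j) (c j))) +
        ∑ l, QuotientAddGroup.mk' relations (of (RG (t l) (d l))) := by
  obtain ⟨pm, qm, _, hEq⟩ := hN
  set r₀ : ℝ := ((pm.coeff 0 : ℚ) : ℝ) / ((qm.coeff 0 : ℚ) : ℝ) with hr₀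
  have hr₀A : IsAlgebraic ℚ r₀ := by
    rw [hr₀, div_eq_mul_inv]
    exact (isAlgebraic_algebraMap (R := ℚ) (A := ℝ) (pm.coeff 0)).mul
      (isAlgebraic_algebraMap (R := ℚ) (A := ℝ) (qm.coeff 0)).inv
  have hNi : EqOn N.integrand (fun _ => r₀) N.domain := by
    intro x hx; rw [hEq hx]; show MvPolynomial.aeval x pm / MvPolynomial.aeval x qm = r₀
    rw [aeval_fin_zero_eq, aeval_fin_zero_eq]
  have h := of_sub_of_mem_relations_of_eqOn (r := N) (r' := ZA r₀) (by rw [(hZ r₀ hr₀A).1, hNd])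
    (fun x hx => by rw [hNi hx, (hZ r₀ hr₀A).2])
  rw [← QuotientAddGroup.eq_zero_iff] at h
  change QuotientAddGroup.mk' relations _ = 0 at h
  rw [map_sub, sub_eq_zero] at h
  rw [h]
  exact nfD_pt hZ hr₀A (ZA r₀) (hZ r₀ hr₀A).1 (hZ r₀ hr₀A).2

/-! ## Box rigidity in dimensions `≤ 1` -/

/-- **`BoxRigidity` in dimensions `m, m' ≤ 1`** — the literal instance of the registered stub
`stub_boxRigidity` (Conjecture 1 frozen to box-rational representations) for boxes of dimension at
most one: two representations on open unit boxes of dimensions `m, m' ≤ 1` with integrands of KZ's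
rational shape (`IsRational`) and equal values are KZ-equivalent. Proof: both classes are mixed normal
forms (`nfD_of_isRational_one` — reduced form, the end points cost nothing by integrability —,
`nfD_of_isRational_zero`), so is their difference (`nfD_neg`, `nfD_add`), whose value vanishes; by
`nfD_eq_zero_of_eval_eq_zero` (Baker) it is a relation. Values covered: `ℚ̄ ∩ (ℚ + Σ ℚ̄ log ℚ̄ + ℚ̄π)`,
e.g. `log 2 = ∫₀¹dx/(1+x)`, `π/4 = ∫₀¹dx/(1+x²)`. [cite: KontsevichZagier2001, §1.2 Conjecture 1] -/
theorem boxRigidity_of_le_one : ∀ (m m' : ℕ), m ≤ 1 → m' ≤ 1 →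
    ∀ (N : IntegralRep m) (N' : IntegralRep m'),
      N.domain = {x | ∀ i, x i ∈ Set.Ioo (0:ℝ) 1} → N.IsRational →
      N'.domain = {x | ∀ i, x i ∈ Set.Ioo (0:ℝ) 1} → N'.IsRational → N.value = N'.value →
      Equivalent N N' := by
  classical
  obtain ⟨RA, hR⟩ := exists_carrierA
  obtain ⟨ZA, hZ⟩ := exists_ptCarrierA
  obtain ⟨RG, hRG⟩ := exists_angCarrier
  -- every rational representation on a unit box of dimension `≤ 1` is a mixed normal form
  have key : ∀ (m : ℕ), m ≤ 1 → ∀ (N : IntegralRep m), N.domain = {x | ∀ i, x i ∈ Set.Ioo (0:ℝ) 1} →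
      N.IsRational →
      ∃ (r : ℝ) (k : ℕ) (u c : Fin k → ℝ) (k' : ℕ) (t d : Fin k' → ℝ), IsAlgebraic ℚ r ∧ (∀ j, 1 < u j) ∧
        (∀ j, IsAlgebraic ℚ (u j)) ∧ (∀ j, IsAlgebraic ℚ (c j)) ∧ (∀ l, 0 ≤ t l) ∧
        (∀ l, IsAlgebraic ℚ (t l)) ∧ (∀ l, IsAlgebraic ℚ (d l)) ∧
        QuotientAddGroup.mk' relations (of N) = QuotientAddGroup.mk' relations (of (ZA r)) +
          ∑ j, QuotientAddGroup.mk' relations (of (RA 1 (u j) (c j))) +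
          ∑ l, QuotientAddGroup.mk' relations (of (RG (t l) (d l))) := by
    intro m hm N hNd hN
    obtain rfl | rfl : m = 0 ∨ m = 1 := by omega
    · refine nfD_of_isRational_zero hZ N ?_ hN
      rw [hNd]; ext x; simp
    · refine nfD_of_isRational_one hR hZ hRG N ?_ hN
      rw [hNd]; ext x; simp [Fin.forall_fin_one]
  intro m m' hm hm' N N' hNd hN hN'd hN' hv
  have hx := nfD_add hZ (key m hm N hNd hN) (nfD_neg hR hZ hRG (key m' hm' N' hN'd hN'))
  rw [← sub_eq_add_neg, ← map_sub] at hx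
  obtain ⟨r, k, u, c, k', t, d, hr, hu1, hu, hc, ht0, ht, hd, hEq⟩ := hx
  have h := nfD_eq_zero_of_eval_eq_zero hR hZ hRG (of N - of N') hr hu1 hu hc ht0 ht hd hEq
    (by rw [map_sub, eval_of, eval_of, hv, sub_self])
  exact (QuotientAddGroup.eq_zero_iff _).mp h

end Dlog

end Summit.KontsevichZagierPeriods.HurwitzMicroSectors.NormalFormPrinciple.PiBox
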